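import Literature.AlgebraicGeometry.Resolution.BlowupStalkCharts
import Literature.AlgebraicGeometry.Resolution.AffineBlowupAlgebra
import HarnessLib

/-!
# [OURS · L1 W4.5(b)] Dictionary: the local rings of a blow-up are localizations of the affine blowup ALGEBRAS `𝒪_{X,s}[J_s/c_j]`

Crux chain w45b, working crux EL♮ = `Theses.EquisingularLift.EquisingularLiftNat` (stmt-ResolutionOfSingularities-20038), research
stub `stub_elnat_three`. OURS; NOT a statement of any manuscript; AI-written, weaker than expert review.
`--supports stmt-ResolutionOfSingularities-20038 --as helper`.

The chain's downstairs kernels for Δ/COMB steps — AVOID-L1 (`…CampaignW45bAvoidBadPoint`), L2 UNIQUE BAD POINT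
(`…CampaignW45bUniqueBadPoint`), L6 Δ-MULT (`…CampaignW45bStrictTransformMultiplicity`) — are statements about primes of the
affine blowup algebra `blowupAlgebra I a = R[I/a] ⊆ R[1/a]` (subalgebra model, `AffineBlowupAlgebra.lean`). The tree's
dictionary `IsBlowup.exists_reesChart_stalk` (`BlowupStalkCharts.lean`, Stacks 0804) presents the local ring of an ABSTRACT
blowing up (`IsBlowup π J`) at a point `x'` over `s` as a localization of the Rees-model chart ring `chartRing c j`. This
file moves that presentation across the chart isomorphism `reesChartEquiv : chartRing c j ≃+* R[I/c_j]` (Stacks 07Z3,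
`AffineBlowupAlgebra.lean`) and packages it as an explicit ring isomorphism, so that the ring-level kernels can be read at the
points of any blow-up:

* `exists_blowupAlgebra_stalk_ringEquiv` — for `x' ∈ X'` and generators `c₁, …, c_k` of `J_s`, `s = π x'`: some `j`, a prime
  `𝔔` of `𝒪_{X,s}[J_s/c_j]` lying over `𝔪_s`, a ring map `χ : 𝒪_{X,s}[J_s/c_j] → 𝒪_{X',x'}` extending `π^♯_{x'}`, and a ring
  isomorphism `𝒪_{X',x'} ≅ (𝒪_{X,s}[J_s/c_j])_𝔔` sending `χ b ↦ b/1`;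
* `exists_blowupAlgebra_stalk_ringEquiv_of_eq` — the same for any ideal `I = (c₁, …, c_k)` of `𝒪_{X,s}` equal to `J_s` (a
  consumer writes `I = Ideal.span {e, w}`, `c = ![e, w]`);
* `exists_isRegularLocalRing_stalk_iff` — hence `𝒪_{X',x'}` is regular iff `(𝒪_{X,s}[J_s/c_j])_𝔔` is, with the membership
  dictionary `a ∈ 𝔪_s ↔ a/1 ∈ 𝔔`.

References: The Stacks Project, Tags 0804, 07Z3; res-L1-w45b-plan-1 CRUX-PLAN v1.1 §3.4 (OURS).
-/

noncomputable section

set_option linter.dupNamespace false -- mandated namespace `Summit.<Summit>.<Problem>` of this single-conjunct summit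

open CategoryTheory AlgebraicGeometry TopologicalSpace IsLocalRing
open Literature.AlgebraicGeometry.Resolution

namespace Summit.ResolutionOfSingularities.ResolutionOfSingularities.Cruxes.EquisingularLiftNat.Sections

universe u

variable {X' X : Scheme.{u}} {π : X' ⟶ X} {J : X.IdealSheafData}

set_option maxHeartbeats 800000 in -- instance unification on the Rees chart ring `chartRing c j` is slow (cf. `BlowupDimension.lean`)
/-- **The local rings of a blowing up are localizations of the affine blowup algebras `𝒪_{X,s}[J_s/c_j]`.** For a blowing up
`π : X' → X` along `J` (`IsBlowup`), `x' ∈ X'`, `s = π x'`, and generators `c₁, …, c_k` of the stalk `J_s`: for some `j` there are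
a prime `𝔔` of `R[I/c_j]` (`R = 𝒪_{X,s}`, `I = J_s = (c)`) over `𝔪_s`, a ring map `χ : R[I/c_j] → 𝒪_{X',x'}` with
`χ ∘ (R → R[I/c_j]) = π^♯_{x'}`, and a ring isomorphism `𝒪_{X',x'} ≅ R[I/c_j]_𝔔` with `χ b ↦ b/1` — `IsBlowup.exists_reesChart_stalk`
transported along `reesChartEquiv`. [cite: StacksProject, Tag 0804] -/
theorem exists_blowupAlgebra_stalk_ringEquiv (hπ : IsBlowup π J) (x' : X') {k : ℕ}
    (c : Fin k → X.presheaf.stalk (π x')) (hc : Ideal.span (Set.range c) = stalkIdeal J (π x')) :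
    ∃ (j : Fin k) (𝔔 : PrimeSpectrum (blowupAlgebra (Ideal.span (Set.range c)) (c j)))
      (χ : blowupAlgebra (Ideal.span (Set.range c)) (c j) →+* X'.presheaf.stalk x')
      (e : X'.presheaf.stalk x' ≃+* Localization.AtPrime 𝔔.asIdeal),
      (∀ a, χ (algebraMap _ _ a) = (π.stalkMap x').hom a) ∧
      (∀ b, e (χ b) = algebraMap _ (Localization.AtPrime 𝔔.asIdeal) b) ∧
      𝔔.asIdeal.comap (algebraMap _ (blowupAlgebra (Ideal.span (Set.range c)) (c j))) =
        maximalIdeal (X.presheaf.stalk (π x')) := by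
  obtain ⟨j, 𝔴, χ₀, h1, hloc, h𝔴⟩ := hπ.exists_reesChart_stalk x' c hc
  -- the chart isomorphism `ε : B_j ≃ R[I/c_j]`, the prime `𝔔 = ε(𝔴)` and `χ = χ₀ ∘ ε⁻¹`
  obtain ⟨ε, hε⟩ : ∃ ε : chartRing c j ≃+* blowupAlgebra (Ideal.span (Set.range c)) (c j),
      ∀ a, ε (chartBase c j a) = algebraMap _ (blowupAlgebra (Ideal.span (Set.range c)) (c j)) a :=
    ⟨reesChartEquiv (I := Ideal.span (Set.range c)) (c j) (Ideal.mem_span_range_self (f := c) (x := j)),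
      reesChartEquiv_reesChartBase (c j) _⟩
  obtain ⟨𝔔, hmem𝔔⟩ : ∃ 𝔔 : PrimeSpectrum (blowupAlgebra (Ideal.span (Set.range c)) (c j)),
      ∀ b, b ∈ 𝔔.asIdeal ↔ ε.symm b ∈ 𝔴.asIdeal :=
    ⟨⟨Ideal.comap ε.symm.toRingHom 𝔴.asIdeal, Ideal.comap_isPrime ε.symm.toRingHom 𝔴.asIdeal⟩,
      fun b => Ideal.mem_comap⟩
  have hεbase : ∀ a, ε.symm (algebraMap _ (blowupAlgebra (Ideal.span (Set.range c)) (c j)) a) = chartBase c j a := by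
    intro a
    rw [← hε, RingEquiv.symm_apply_apply]
  obtain ⟨χ, hχ⟩ : ∃ χ : blowupAlgebra (Ideal.span (Set.range c)) (c j) →+* X'.presheaf.stalk x',
      ∀ b, χ b = χ₀ (ε.symm b) := ⟨χ₀.comp ε.symm.toRingHom, fun b => rfl⟩
  -- the three localization axioms, transported elementwise along the bijection `ε`
  have hU : ∀ y : 𝔴.asIdeal.primeCompl, IsUnit (χ₀ y) := fun y =>
    @IsLocalization.map_units _ _ 𝔴.asIdeal.primeCompl _ _ χ₀.toAlgebra hloc y
  have hS : ∀ z : X'.presheaf.stalk x', ∃ x : chartRing c j × 𝔴.asIdeal.primeCompl, z * χ₀ x.2 = χ₀ x.1 := fun z =>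
    @IsLocalization.surj _ _ 𝔴.asIdeal.primeCompl _ _ χ₀.toAlgebra hloc z
  have hE : ∀ {x y : chartRing c j}, χ₀ x = χ₀ y → ∃ d : 𝔴.asIdeal.primeCompl, (d : chartRing c j) * x = d * y :=
    fun {x y} h => @IsLocalization.exists_of_eq _ _ 𝔴.asIdeal.primeCompl _ _ χ₀.toAlgebra hloc x y h
  have hmemε : ∀ b₀ : chartRing c j, ε b₀ ∈ 𝔔.asIdeal ↔ b₀ ∈ 𝔴.asIdeal := fun b₀ => by
    rw [hmem𝔔, RingEquiv.symm_apply_apply]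
  have hLM : 𝔔.asIdeal.primeCompl.IsLocalizationMap (χ : _ → X'.presheaf.stalk x') :=
    { map_units := fun y => by
        have hy' : ε.symm (y : blowupAlgebra (Ideal.span (Set.range c)) (c j)) ∈ 𝔴.asIdeal.primeCompl :=
          fun h => y.2 ((hmem𝔔 _).mpr h)
        have hu := hU ⟨_, hy'⟩
        rwa [← hχ] at hu
      surj := fun z => by
        obtain ⟨⟨x₀, ⟨y₀, hy₀⟩⟩, hz⟩ := hS z
        have hy : ε y₀ ∈ 𝔔.asIdeal.primeCompl := fun h => hy₀ ((hmemε y₀).mp h)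
        refine ⟨⟨ε x₀, ⟨ε y₀, hy⟩⟩, ?_⟩
        have e1 : χ (ε y₀) = χ₀ y₀ := by rw [hχ, RingEquiv.symm_apply_apply]
        have e2 : χ (ε x₀) = χ₀ x₀ := by rw [hχ, RingEquiv.symm_apply_apply]
        simpa only [e1, e2] using hz
      exists_of_eq := fun {x y} hxy => by
        rw [hχ, hχ] at hxy
        obtain ⟨⟨d₀, hd₀⟩, hd⟩ := hE hxy
        have hd' : ε d₀ ∈ 𝔔.asIdeal.primeCompl := fun h => hd₀ ((hmemε d₀).mp h)
        refine ⟨⟨ε d₀, hd'⟩, ε.symm.injective ?_⟩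
        simpa only [map_mul, RingEquiv.symm_apply_apply] using hd }
  have hloc' : @IsLocalization.AtPrime _ _ (X'.presheaf.stalk x') _ χ.toAlgebra 𝔔.asIdeal _ := by
    letI := χ.toAlgebra
    exact (isLocalization_iff_isLocalizationMap _ _).mpr hLM
  -- `𝒪_{X',x'} ≅ R[I/c_j]_𝔔`: both are localizations of `R[I/c_j]` at `𝔔`
  letI := χ.toAlgebra
  haveI : IsLocalization.AtPrime (X'.presheaf.stalk x') 𝔔.asIdeal := hloc'
  let e : X'.presheaf.stalk x' ≃ₐ[blowupAlgebra (Ideal.span (Set.range c)) (c j)] Localization.AtPrime 𝔔.asIdeal :=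
    IsLocalization.algEquiv 𝔔.asIdeal.primeCompl _ _
  refine ⟨j, 𝔔, χ, e.toRingEquiv, fun a => ?_, fun b => e.commutes b, ?_⟩
  · rw [hχ, hεbase]
    exact h1 a
  · rw [← h𝔴]
    ext a
    rw [Ideal.mem_comap, Ideal.mem_comap, hmem𝔔, hεbase]

/-- The same presentation for any ideal `I` of `𝒪_{X,s}` written as `(c₁, …, c_k)` — e.g. `I = (e, w)` with `c = ![e, w]` —
so that the chart algebra is literally `blowupAlgebra I (c j)`. [cite: StacksProject, Tag 0804] -/
theorem exists_blowupAlgebra_stalk_ringEquiv_of_eq (hπ : IsBlowup π J) (x' : X') {k : ℕ}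
    (c : Fin k → X.presheaf.stalk (π x')) (I : Ideal (X.presheaf.stalk (π x')))
    (hI : I = Ideal.span (Set.range c)) (hc : I = stalkIdeal J (π x')) :
    ∃ (j : Fin k) (𝔔 : PrimeSpectrum (blowupAlgebra I (c j))) (χ : blowupAlgebra I (c j) →+* X'.presheaf.stalk x')
      (e : X'.presheaf.stalk x' ≃+* Localization.AtPrime 𝔔.asIdeal),
      (∀ a, χ (algebraMap _ _ a) = (π.stalkMap x').hom a) ∧
      (∀ b, e (χ b) = algebraMap _ (Localization.AtPrime 𝔔.asIdeal) b) ∧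
      𝔔.asIdeal.comap (algebraMap _ (blowupAlgebra I (c j))) = maximalIdeal (X.presheaf.stalk (π x')) := by
  subst hI
  exact exists_blowupAlgebra_stalk_ringEquiv hπ x' c hc

/-- **Regularity of the points of a blow-up is read on the affine blowup algebras**: in the situation of
`exists_blowupAlgebra_stalk_ringEquiv_of_eq`, `𝒪_{X',x'}` is a regular local ring iff the localization `R[I/c_j]_𝔔` is, and
`a ∈ 𝔪_s ↔ a/1 ∈ 𝔔`. [cite: StacksProject, Tag 0804] -/
theorem exists_isRegularLocalRing_stalk_iff (hπ : IsBlowup π J) (x' : X') {k : ℕ}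
    (c : Fin k → X.presheaf.stalk (π x')) (I : Ideal (X.presheaf.stalk (π x')))
    (hI : I = Ideal.span (Set.range c)) (hc : I = stalkIdeal J (π x')) :
    ∃ (j : Fin k) (𝔔 : PrimeSpectrum (blowupAlgebra I (c j))),
      (∀ a, a ∈ maximalIdeal (X.presheaf.stalk (π x')) ↔ algebraMap _ (blowupAlgebra I (c j)) a ∈ 𝔔.asIdeal) ∧
      (IsRegularLocalRing (X'.presheaf.stalk x') ↔ IsRegularLocalRing (Localization.AtPrime 𝔔.asIdeal)) := by
  obtain ⟨j, 𝔔, χ, e, -, -, h𝔔⟩ := exists_blowupAlgebra_stalk_ringEquiv_of_eq hπ x' c I hI hc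
  refine ⟨j, 𝔔, fun a => by rw [← h𝔔, Ideal.mem_comap], ?_⟩
  exact ⟨fun h => @IsRegularLocalRing.of_ringEquiv _ _ h _ _ e, fun h => @IsRegularLocalRing.of_ringEquiv _ _ h _ _ e.symm⟩

end Summit.ResolutionOfSingularities.ResolutionOfSingularities.Cruxes.EquisingularLiftNat.Sections

end
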